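import Literature.Analysis.FluidPDE.Tao2016AveragedNS.SplitCascadeTable
import Literature.Analysis.FluidPDE.TaoCascadeOperator
import HarnessLib

/-!
# The split cascade operator is a SPLIT local cascade form (packaging over the support of the table)

T. Tao, *Finite time blowup for an averaged three-dimensional Navier–Stokes equation*, J. Amer. Math.
Soc. **29** (2016), 601–674 = arXiv:1402.0290v3, §3 Definition 3.1 (local cascade operators, basic
forms (3.1)), §4 p. 21 ((4.1): "`C` is indeed a local cascade operator (it is a sum of … basic local
cascade operators)"), §3.2 p. 15 / Remark 3.5 (the role of the input frequencies).
HONEST FRAMING (cell harvest/h2-tao-ladder, rung 1 of a ladder of MODEL equations): a statement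
about Tao's cascade operator (4.1) built on wavelet data with small, modulus-separated frequency
balls and a SQUARE-FREE table; nothing here concerns the true Navier–Stokes equations.

The crux `SplitCascadeBlowup` of route TaoLadderRungOne asks for a trilinear form that is a finite
real combination `∑ⱼ cⱼ · basicCascadeForm ε₀ ψⱼ₁ ψⱼ₂ ψⱼ₃` whose profiles have annular Fourier
support, Fourier support in balls of radius `ε₀/64` about `±ζⱼᵢ`, and INPUT MODULI GAP
`|‖ζⱼ₁‖ - ‖ζⱼ₂‖| ≥ ε₀/20`. This file proves that the cascade operator `cascadeOperatorForm ε₀ 𝒟.ψ α`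
has such a representation whenever the wavelet data `𝒟` have ball radii `≤ ε₀/128`, centre moduli
in `(1, 1+ε₀/2]` with pairwise gaps `≥ ε₀/20`, and the table `α` is square-free
(`TaoCascade.IsSquareFreeCoeff`): index the combination by `(i₁,i₂,i₃,μ) ∈ Fin m³ × S` as in the
tree's `isLocalCascadeForm_cascadeOperatorForm`, with the shifted profiles `Dil_{1+ε₀}^{μᵢ} ψᵢ`
(centres `(1+ε₀)^{μᵢ}ζᵢ`, radii `≤ (1+ε₀)ε₀/128 ≤ ε₀/64`); at the entries where `α = 0` (where the
gap may fail, e.g. `i₁ = i₂`) use instead the dummy admissible triple `(Dil_{1+ε₀}ψ_{i₁}, ψ_{i₁}, ψ_{i₁})`,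
whose coefficient is `0`. The gap: for `μ₁ = μ₂` square-freeness gives `i₁ ≠ i₂` (the data's gap);
for `μ₁ ≠ μ₂` one input is dilated and `(1+ε₀)‖ζ‖ - ‖ζ'‖ > (1+ε₀) - (1+ε₀/2) = ε₀/2`.
Main result: `cascadeOperatorForm_isSplitLocalCascadeForm`. Theorems only.

## References

* T. Tao, J. Amer. Math. Soc. 29 (2016), 601–674 = arXiv:1402.0290v3, Def. 3.1, §4 (4.1) p. 21,
  §3.2 p. 15. [`Tao2016AveragedNS`]
-/

noncomputable section

open MeasureTheory Set Filter FourierTransform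
open scoped SchwartzMap

namespace Literature.Analysis.FluidPDE

namespace Tao2016AveragedNS

open Tao2016

section Packaging

variable {ε₀ : ℝ} {m : ℕ}

/-- `‖s • ζ‖ = s‖ζ‖` for `s ≥ 0`. [folklore] -/
private theorem norm_smul_of_nonneg {s : ℝ} (hs : 0 ≤ s) (ζ : EuclideanSpace ℝ (Fin 3)) :
    ‖s • ζ‖ = s * ‖ζ‖ := by
  rw [norm_smul, Real.norm_eq_abs, abs_of_nonneg hs]

/-- `dist(-x, y) = dist(x, -y)`. [folklore] -/
private theorem dist_neg_eq (x y : EuclideanSpace ℝ (Fin 3)) : dist (-x) y = dist x (-y) := by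
  rw [dist_eq_norm, dist_eq_norm, show -x - y = -(x - -y) by abel, norm_neg]

/-- Dilating both arguments by `(1+ε₀)⁻¹`: `dist((1+ε₀)⁻¹ξ, η) = (1+ε₀)⁻¹·dist(ξ, (1+ε₀)η)`. [folklore] -/
private theorem dist_inv_smul (hl : 0 < 1 + ε₀) (ξ η : EuclideanSpace ℝ (Fin 3)) :
    dist ((1 + ε₀)⁻¹ • ξ) η = (1 + ε₀)⁻¹ * dist ξ ((1 + ε₀) • η) := by
  rw [dist_eq_norm, dist_eq_norm, ← norm_smul_of_nonneg (inv_pos.2 hl).le, smul_sub, smul_smul,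
    inv_mul_cancel₀ hl.ne', one_smul]

/-- **Fourier support of a shifted profile.** For wavelet data with ball radius `≤ ε₀/128`
(`0 < ε₀ ≤ 1`), the profile `shiftProfile (1+ε₀) k ψᵢ` (`= Dil_{1+ε₀}ψᵢ` if `k = 1`, else `ψᵢ`) has
Fourier transform vanishing at every `ξ` at distance `> ε₀/64` from both `±sζᵢ`,
`s = 1+ε₀` if `k = 1` else `1`. [cite: Tao2016AveragedNS, §4 p. 21] -/
theorem fourier_shiftProfile_eq_zero (hε₀ : 0 < ε₀) (hε₀1 : ε₀ ≤ 1) (𝒟 : CascadeWaveletData ε₀ m)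
    (hrad : ∀ i, 𝒟.radius i ≤ ε₀ / 128) (k : ℤ) (i : Fin m) (ξ : EuclideanSpace ℝ (Fin 3))
    (h1 : ε₀ / 64 < dist ξ ((if k = 1 then 1 + ε₀ else 1) • 𝒟.center i))
    (h2 : ε₀ / 64 < dist ξ (-((if k = 1 then 1 + ε₀ else 1) • 𝒟.center i))) :
    𝓕 (FunctionSpaces.EuclideanSpace.complexify ∘
      ⇑(shiftProfile (Units.mk0 (1 + ε₀) (by positivity : (0 : ℝ) < 1 + ε₀).ne') k (𝒟.ψ i))) ξ = 0 := by
  have hl : (0 : ℝ) < 1 + ε₀ := by positivity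
  have hr := hrad i
  unfold shiftProfile
  split_ifs with hk
  · -- dilated profile: `𝓕(Dil ψ)(ξ) = c • 𝓕ψ((1+ε₀)⁻¹ξ)`
    rw [if_pos hk] at h1 h2
    rw [fourier_complexify_schwartzDil, Units.val_mk0]
    suffices h0 : 𝓕 (FunctionSpaces.EuclideanSpace.complexify ∘ ⇑(𝒟.ψ i)) ((1 + ε₀)⁻¹ • ξ) = 0 by
      rw [h0, smul_zero, smul_zero]
    -- `dist((1+ε₀)⁻¹ξ', ζ) = (1+ε₀)⁻¹ dist(ξ', (1+ε₀)ζ) > (1+ε₀)⁻¹ ε₀/64 ≥ ε₀/128 ≥ r`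
    have hkey : ∀ ξ' : EuclideanSpace ℝ (Fin 3), ε₀ / 64 < dist ξ' ((1 + ε₀) • 𝒟.center i) →
        (1 + ε₀)⁻¹ • ξ' ∉ Metric.ball (𝒟.center i) (𝒟.radius i) := by
      intro ξ' hξ' hmem
      rw [Metric.mem_ball, dist_inv_smul hl] at hmem
      have h3 : (1 + ε₀)⁻¹ * (ε₀ / 64) < (1 + ε₀)⁻¹ * dist ξ' ((1 + ε₀) • 𝒟.center i) :=
        mul_lt_mul_of_pos_left hξ' (inv_pos.2 hl)
      have h4 : ε₀ / 128 ≤ (1 + ε₀)⁻¹ * (ε₀ / 64) := by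
        rw [le_inv_mul_iff₀ hl]; nlinarith
      linarith
    refine 𝒟.fourier_support i _ (hkey ξ h1) ?_
    rw [← smul_neg]
    refine hkey (-ξ) ?_
    rw [dist_neg_eq]
    exact h2
  · -- undilated profile
    rw [if_neg hk, one_smul] at h1 h2
    refine 𝒟.fourier_support i ξ (fun hmem => ?_) (fun hmem => ?_)
    · rw [Metric.mem_ball] at hmem
      linarith
    · rw [Metric.mem_ball, dist_neg_eq] at hmem
      linarith

/-- **The input-moduli gap of a non-zero entry of a square-free table.** With centre moduli in
`(1, 1+ε₀/2]` pairwise `≥ ε₀/20` apart: for `μ = shiftVec k ∈ S` and `μ₁ = μ₂ → i₁ ≠ i₂`, the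
shifted centres satisfy `|‖s(μ₁)ζ_{i₁}‖ - ‖s(μ₂)ζ_{i₂}‖| ≥ ε₀/20`. [cite: Tao2016AveragedNS, §3.2 p. 15] -/
theorem shifted_moduli_gap (hε₀ : 0 < ε₀) (𝒟 : CascadeWaveletData ε₀ m)
    (hnorm : ∀ i, 1 < ‖𝒟.center i‖ ∧ ‖𝒟.center i‖ ≤ 1 + ε₀ / 2)
    (hgap : ∀ i j, i ≠ j → ε₀ / 20 ≤ |‖𝒟.center i‖ - ‖𝒟.center j‖|) (k : Fin 4) (i₁ i₂ : Fin m)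
    (hne : (shiftVec k).1 = (shiftVec k).2.1 → i₁ ≠ i₂) :
    ε₀ / 20 ≤ |‖(if (shiftVec k).1 = 1 then 1 + ε₀ else 1) • 𝒟.center i₁‖ -
      ‖(if (shiftVec k).2.1 = 1 then 1 + ε₀ else 1) • 𝒟.center i₂‖| := by
  have hl : (0 : ℝ) ≤ 1 + ε₀ := by positivity
  have h1 := hnorm i₁
  have h2 := hnorm i₂
  fin_cases k
  · -- `μ = (0,0,0)`: same scale, distinct modes
    show ε₀ / 20 ≤ |‖(if (0 : ℤ) = 1 then 1 + ε₀ else 1) • 𝒟.center i₁‖ -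
      ‖(if (0 : ℤ) = 1 then 1 + ε₀ else 1) • 𝒟.center i₂‖|
    rw [if_neg (by decide), one_smul, one_smul]
    exact hgap i₁ i₂ (hne rfl)
  · -- `μ = (1,0,0)`: first input dilated
    show ε₀ / 20 ≤ |‖(if (1 : ℤ) = 1 then 1 + ε₀ else 1) • 𝒟.center i₁‖ -
      ‖(if (0 : ℤ) = 1 then 1 + ε₀ else 1) • 𝒟.center i₂‖|
    rw [if_pos rfl, if_neg (by decide), one_smul, norm_smul_of_nonneg hl]
    refine le_trans ?_ (le_abs_self _)
    nlinarith
  · -- `μ = (0,1,0)`: second input dilated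
    show ε₀ / 20 ≤ |‖(if (0 : ℤ) = 1 then 1 + ε₀ else 1) • 𝒟.center i₁‖ -
      ‖(if (1 : ℤ) = 1 then 1 + ε₀ else 1) • 𝒟.center i₂‖|
    rw [if_pos rfl, if_neg (by decide), one_smul, norm_smul_of_nonneg hl]
    refine le_trans ?_ (neg_le_abs _)
    nlinarith
  · -- `μ = (0,0,1)`: same scale, distinct modes
    show ε₀ / 20 ≤ |‖(if (0 : ℤ) = 1 then 1 + ε₀ else 1) • 𝒟.center i₁‖ -
      ‖(if (0 : ℤ) = 1 then 1 + ε₀ else 1) • 𝒟.center i₂‖|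
    rw [if_neg (by decide), one_smul, one_smul]
    exact hgap i₁ i₂ (hne rfl)

/-- `shiftVec k ∈ S`. [cite: Tao2016AveragedNS, §4 after (4.1)] -/
private theorem shiftVec_mem (k : Fin 4) : shiftVec k ∈ TaoCascade.shiftSet := by
  fin_cases k <;> decide

/-- Reindexing a `Fintype`-indexed split representation along `Fintype.equivFin`. [folklore] -/
private theorem reindex_split {ι : Type*} [Fintype ι] {T : L2C → L2C → L2C → ℂ}
    (c : ι → ℝ) (φ : ι → Fin 3 → 𝓢(EuclideanSpace ℝ (Fin 3), EuclideanSpace ℝ (Fin 3)))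
    (z : ι → Fin 3 → EuclideanSpace ℝ (Fin 3))
    (hA : ∀ j i, HasAnnularFourierSupport ε₀ (φ j i))
    (hB : ∀ j i, ∀ ξ : EuclideanSpace ℝ (Fin 3), ε₀ / 64 < dist ξ (z j i) →
      ε₀ / 64 < dist ξ (-z j i) → 𝓕 (FunctionSpaces.EuclideanSpace.complexify ∘ ⇑(φ j i)) ξ = 0)
    (hG : ∀ j, ε₀ / 20 ≤ |‖z j 0‖ - ‖z j 1‖|)
    (hT : ∀ u v w, MemH10df u → MemH10df v → MemH10dfC w →
      T u v w = ∑ j, (c j : ℂ) * basicCascadeForm ε₀ (φ j 0) (φ j 1) (φ j 2) u v w) :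
    ∃ (k : ℕ) (c : Fin k → ℝ)
      (ψ : Fin k → Fin 3 → 𝓢(EuclideanSpace ℝ (Fin 3), EuclideanSpace ℝ (Fin 3)))
      (ζ : Fin k → Fin 3 → EuclideanSpace ℝ (Fin 3)),
      (∀ j i, HasAnnularFourierSupport ε₀ (ψ j i)) ∧
      (∀ j i, ∀ ξ : EuclideanSpace ℝ (Fin 3), ε₀ / 64 < dist ξ (ζ j i) →
        ε₀ / 64 < dist ξ (-ζ j i) → 𝓕 (FunctionSpaces.EuclideanSpace.complexify ∘ ⇑(ψ j i)) ξ = 0) ∧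
      (∀ j, ε₀ / 20 ≤ |‖ζ j 0‖ - ‖ζ j 1‖|) ∧
      ∀ u v w, MemH10df u → MemH10df v → MemH10dfC w →
        T u v w = ∑ j, (c j : ℂ) * basicCascadeForm ε₀ (ψ j 0) (ψ j 1) (ψ j 2) u v w := by
  refine ⟨Fintype.card ι, c ∘ (Fintype.equivFin ι).symm, φ ∘ (Fintype.equivFin ι).symm,
    z ∘ (Fintype.equivFin ι).symm, fun j i => hA _ i, fun j i => hB _ i, fun j => hG _,
    fun u v w hu hv hw => ?_⟩
  rw [hT u v w hu hv hw]
  exact (Equiv.sum_comp (Fintype.equivFin ι).symm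
    (fun j => (c j : ℂ) * basicCascadeForm ε₀ (φ j 0) (φ j 1) (φ j 2) u v w)).symm

/-- **The cascade operator (4.1) on split wavelet data with a square-free table is a SPLIT local
cascade form.** For `0 < ε₀ ≤ 1`, wavelet data `𝒟` with ball radii `≤ ε₀/128` and centre moduli in
`(1, 1+ε₀/2]` pairwise `≥ ε₀/20` apart, and a square-free table `α`: `cascadeOperatorForm ε₀ 𝒟.ψ α`
is a finite real combination of basic local cascade forms (3.1) whose profiles have annular Fourier
support, Fourier support within distance `ε₀/64` of `±ζⱼᵢ`, and input moduli gap
`|‖ζⱼ₁‖ - ‖ζⱼ₂‖| ≥ ε₀/20`. [cite: Tao2016AveragedNS, Def. 3.1; §4 p. 21; §3.2 p. 15] -/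
theorem cascadeOperatorForm_isSplitLocalCascadeForm (hε₀ : 0 < ε₀) (hε₀1 : ε₀ ≤ 1)
    (𝒟 : CascadeWaveletData ε₀ m) (hrad : ∀ i, 𝒟.radius i ≤ ε₀ / 128)
    (hnorm : ∀ i, 1 < ‖𝒟.center i‖ ∧ ‖𝒟.center i‖ ≤ 1 + ε₀ / 2)
    (hgap : ∀ i j, i ≠ j → ε₀ / 20 ≤ |‖𝒟.center i‖ - ‖𝒟.center j‖|)
    {α : Fin m → Fin m → Fin m → ℤ × ℤ × ℤ → ℝ} (hsq : TaoCascade.IsSquareFreeCoeff α) :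
    ∃ (k : ℕ) (c : Fin k → ℝ)
      (ψ : Fin k → Fin 3 → 𝓢(EuclideanSpace ℝ (Fin 3), EuclideanSpace ℝ (Fin 3)))
      (ζ : Fin k → Fin 3 → EuclideanSpace ℝ (Fin 3)),
      (∀ j i, HasAnnularFourierSupport ε₀ (ψ j i)) ∧
      (∀ j i, ∀ ξ : EuclideanSpace ℝ (Fin 3), ε₀ / 64 < dist ξ (ζ j i) →
        ε₀ / 64 < dist ξ (-ζ j i) → 𝓕 (FunctionSpaces.EuclideanSpace.complexify ∘ ⇑(ψ j i)) ξ = 0) ∧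
      (∀ j, ε₀ / 20 ≤ |‖ζ j 0‖ - ‖ζ j 1‖|) ∧
      ∀ u v w, MemH10df u → MemH10df v → MemH10dfC w →
        cascadeOperatorForm ε₀ 𝒟.ψ α u v w =
          ∑ j, (c j : ℂ) * basicCascadeForm ε₀ (ψ j 0) (ψ j 1) (ψ j 2) u v w := by
  classical
  have hl : (0 : ℝ) < 1 + ε₀ := by positivity
  /- Index set `(i₁,i₂,i₃,k)`; for each index the three SLOTS are described by a mode index
  `iv p s : Fin m` and a shift `kv p s : ℤ` (the dummy triple `(Dil ψ_{i₁}, ψ_{i₁}, ψ_{i₁})` at the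
  zero entries of `α`); profile `shiftProfile (kv p s) ψ_{iv p s}`, centre `s(kv p s) • ζ_{iv p s}`. -/
  let iv : Fin m × Fin m × Fin m × Fin 4 → Fin 3 → Fin m := fun p =>
    if α p.1 p.2.1 p.2.2.1 (shiftVec p.2.2.2) = 0 then ![p.1, p.1, p.1] else ![p.1, p.2.1, p.2.2.1]
  let kv : Fin m × Fin m × Fin m × Fin 4 → Fin 3 → ℤ := fun p =>
    if α p.1 p.2.1 p.2.2.1 (shiftVec p.2.2.2) = 0 then ![1, 0, 0]
    else ![(shiftVec p.2.2.2).1, (shiftVec p.2.2.2).2.1, (shiftVec p.2.2.2).2.2]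
  refine reindex_split (ι := Fin m × Fin m × Fin m × Fin 4)
    (fun p => α p.1 p.2.1 p.2.2.1 (shiftVec p.2.2.2))
    (fun p s => shiftProfile (Units.mk0 (1 + ε₀) hl.ne') (kv p s) (𝒟.ψ (iv p s)))
    (fun p s => (if kv p s = 1 then 1 + ε₀ else 1) • 𝒟.center (iv p s))
    (fun p s => 𝒟.hasAnnularFourierSupport_shiftProfile hε₀ hε₀1 _ _)
    (fun p s ξ hξ1 hξ2 => fourier_shiftProfile_eq_zero hε₀ hε₀1 𝒟 hrad _ _ ξ hξ1 hξ2)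
    (fun p => ?_) (fun u v w _ _ _ => ?_)
  · -- input-moduli gap
    obtain ⟨i₁, i₂, i₃, k⟩ := p
    by_cases h0 : α i₁ i₂ i₃ (shiftVec k) = 0
    · -- dummy triple: `|(1+ε₀)‖ζ‖ - ‖ζ‖| = ε₀‖ζ‖ ≥ ε₀`
      have hk0 : kv (i₁, i₂, i₃, k) 0 = 1 := by simp only [kv, h0, if_true, Matrix.cons_val_zero]
      have hk1 : kv (i₁, i₂, i₃, k) 1 = 0 := by simp only [kv, h0, if_true, Matrix.cons_val_one,
        Matrix.cons_val_zero]
      have hi0 : iv (i₁, i₂, i₃, k) 0 = i₁ := by simp only [iv, h0, if_true, Matrix.cons_val_zero]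
      have hi1 : iv (i₁, i₂, i₃, k) 1 = i₁ := by simp only [iv, h0, if_true, Matrix.cons_val_one,
        Matrix.cons_val_zero]
      beta_reduce
      rw [hk0, hk1, hi0, hi1, if_pos rfl, if_neg (by decide), one_smul, norm_smul_of_nonneg hl.le]
      refine le_trans ?_ (le_abs_self _)
      nlinarith [(hnorm i₁).1]
    · have hk0 : kv (i₁, i₂, i₃, k) 0 = (shiftVec k).1 := by
        simp only [kv, h0, if_false, Matrix.cons_val_zero]
      have hk1 : kv (i₁, i₂, i₃, k) 1 = (shiftVec k).2.1 := by
        simp only [kv, h0, if_false, Matrix.cons_val_one, Matrix.cons_val_zero]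
      have hi0 : iv (i₁, i₂, i₃, k) 0 = i₁ := by simp only [iv, h0, if_false, Matrix.cons_val_zero]
      have hi1 : iv (i₁, i₂, i₃, k) 1 = i₂ := by
        simp only [iv, h0, if_false, Matrix.cons_val_one, Matrix.cons_val_zero]
      beta_reduce
      rw [hk0, hk1, hi0, hi1]
      refine shifted_moduli_gap hε₀ 𝒟 hnorm hgap k i₁ i₂ fun heq hii => h0 ?_
      subst hii
      exact hsq i₁ i₃ _ (shiftVec_mem k) heq
  · -- the identity, term by term
    unfold cascadeOperatorForm basicCascadeForm
    simp only [Fintype.sum_prod_type, sum_shiftSet_eq_sum_shiftVec]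
    refine Finset.sum_congr rfl fun i₁ _ => Finset.sum_congr rfl fun i₂ _ =>
      Finset.sum_congr rfl fun i₃ _ => Finset.sum_congr rfl fun k _ => ?_
    by_cases h0 : α i₁ i₂ i₃ (shiftVec k) = 0
    · simp only [h0, Complex.ofReal_zero, zero_mul]
    · have hk : ∀ s, kv (i₁, i₂, i₃, k) s =
          ![(shiftVec k).1, (shiftVec k).2.1, (shiftVec k).2.2] s := fun s => by
        simp only [kv, h0, if_false]
      have hi : ∀ s, iv (i₁, i₂, i₃, k) s = ![i₁, i₂, i₃] s := fun s => by
        simp only [iv, h0, if_false]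
      simp only [hk, hi, Matrix.cons_val_zero, Matrix.cons_val_one, Matrix.cons_val]
      congr 1
      refine tsum_congr fun n => ?_
      obtain ⟨h1, h2, h3⟩ := cascadeWavelet_add_shiftVec hl (𝒟.ψ i₁) n k
      obtain ⟨-, h2', -⟩ := cascadeWavelet_add_shiftVec hl (𝒟.ψ i₂) n k
      obtain ⟨-, -, h3'⟩ := cascadeWavelet_add_shiftVec hl (𝒟.ψ i₃) n k
      simp only [h1, h2', h3']

end Packaging

end Tao2016AveragedNS

end Literature.Analysis.FluidPDE
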